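import Literature.NumberTheory.LFunctions.KMVMomentsToHalfEdge
import Literature.NumberTheory.LFunctions.KowalskiMichelPeterssonFormula
import HarnessLib

/-!
# Mollified moments ⇒ the ½-proportion edge at prime level — the two Petersson ROOTS, RE-THREADED to
# the printed range of the Petersson bound (`kowalskiMichel2000_peterssonBound`, R2-G44)

Topic `Literature/NumberTheory/LFunctions` (namespace `Literature.NumberTheory.LFunctions.KMV2000`).
PROOFS only — NO named fact (D-0026). Companion («`_pb` twins», F4 roots) of `KMVMomentsToHalfEdge.lean`
§8: its two theorems that INSTANTIATE the binder `(hP : KowalskiMichel2000.kowalskiMichel2000_petersson)`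
at the mollifier pairs `(l, m)`, `1 ≤ l, m ≤ q̂^Δ` — `KMV2000.abs_pairSum_sub_delta_le` and
`KMV2000.mollifierNormBound_of_petersson`. The old binder is the Petersson display of Kowalski–Michel
2000 p. 310 typed for ALL `m, n ≥ 1`, FALSE at `m = n = q`
(`KowalskiMichel2000.not_kowalskiMichel2000_petersson`; cell record R2-G44, «refuted-as-typed ≠
refuted-in-print»). Here both are re-proved VERBATIM from the fact IN ITS PRINTED RANGE,
`KowalskiMichel2000.kowalskiMichel2000_peterssonBound` (binder `¬ (q ∣ m ∧ q ∣ n)`, i.e. `((m,n),q) = 1`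
at prime `q`; KM2000 §2.3 p. 310 display after (16) with §2.4.2 (23)):

* `abs_pairSum_sub_delta_le_pb` — the binder `¬ (q ∣ l ∧ q ∣ m)` ENTERS THE STATEMENT;
* `mollifierNormBound_of_petersson_pb` — statement unchanged but for the hypothesis; the range condition
  is DISCHARGED inside the proof: `m ≤ ⌊q̂^Δ⌋ ≤ q̂^Δ ≤ (√q)^Δ = q^{Δ/2} < q` (`Δ < 3/2`, `q ≥ 300`), so
  `q ∤ m` (`KowalskiMichel2000.not_dvd_and_dvd_of_lt`).

The three PASS-THROUGH consumers of §§7–9 (`primeLevelFamilyTwo_EStarFam_of_momentAsymptotics`,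
`…_window`, `…_of_beyondDiagonalValue`) are re-threaded in a separate companion over this file and the
re-threaded mass bounds. Old decls untouched; no use of the negated fact (smuggling rule).
«The programme SEARCHES and TYPES; no claim about Landau–Siegel zeros, Theorems 1–2 of arXiv:2211.02515
or a repaired Margin232 until a kernel theorem says so.»

## References

* [KowalskiMichelVanderKam2000] Lemma 3.2 (12) and (9) (mollifier norm shape).
* [KowalskiMichel2000] §2.3 display after (16) IN ITS RANGE (§2.4.2 (23)).
-/

noncomputable section

open scoped Real
open Finset Complex Polynomial CongruenceSubgroup
open Literature.NumberTheory.EllipticCurves.ModularForms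

namespace Literature.NumberTheory.LFunctions

namespace KMV2000

open Literature.NumberTheory.LFunctions.CentralValueFamilyHalfEdge

variable {q : ℕ} [NeZero q]

omit [NeZero q] in
/-- The Petersson pair sums at prime level IN THE PRINTED RANGE: `|H_q(l,m) − δ(l,m)| ≤ C_ε (lm)^{1/2+ε}
q^{−3/2}` for `1 ≤ l, m` with `¬ (q ∣ l ∧ q ∣ m)` (re-thread of `abs_pairSum_sub_delta_le` to the named
fact `kowalskiMichel2000_peterssonBound`, R2-G44). [cite: KowalskiMichel2000, §2.3 (display after (16)) with §2.4.2 (23)] -/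
theorem abs_pairSum_sub_delta_le_pb (hP : KowalskiMichel2000.kowalskiMichel2000_peterssonBound) {ε : ℝ}
    (hε : 0 < ε) :
    ∃ C : ℝ, 0 ≤ C ∧ ∀ (q : ℕ) [NeZero q], q.Prime → ∀ l m : ℕ, 1 ≤ l → 1 ≤ m → ¬ (q ∣ l ∧ q ∣ m) →
      |pairSum q l m - (if l = m then 1 else 0)| ≤
        C * (((l : ℝ) * m) ^ (1 / 2 + ε)) * (q : ℝ) ^ (-(3 / 2 : ℝ)) := by
  obtain ⟨C, hC⟩ := hP ε hε
  refine ⟨max C 0, le_max_right _ _, fun q _ hq l m hl hm hnd ↦ ?_⟩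
  have h := hC q hq l m hl hm hnd
  rw [pet_eq_pairSum] at h
  have e : (((pairSum q l m : ℝ) : ℂ) - (if l = m then 1 else 0)) =
      (((pairSum q l m - (if l = m then 1 else 0) : ℝ)) : ℂ) := by
    split_ifs <;> push_cast <;> ring
  rw [e, Complex.norm_real, Real.norm_eq_abs] at h
  exact le_trans h (mul_le_mul_of_nonneg_right (mul_le_mul_of_nonneg_right (le_max_left _ _)
    (by positivity)) (by positivity))

/-- **The mollifier-norm shape, discharged below `Δ = 3/2`, from the Petersson fact IN ITS PRINTED RANGE**
(re-thread of `mollifierNormBound_of_petersson` to `kowalskiMichel2000_peterssonBound`, R2-G44; the range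
condition `q ∤ m` holds because `m ≤ q̂^Δ ≤ q^{Δ/2} < q`): for every real polynomial `P` and
`0 < Δ < 3/2` there are `C, q₁` with `Σ^h_{f ∈ H_2(q)} ω_f |M_P(f; q̂^Δ)|² ≤ C · log q̂` for all
primes `q ≥ q₁` — the hypothesis `hnorm` of `goodMass_lower_of_momentAsymptotics` /
`primeLevelFamilyTwo_EStarFam_of_momentAsymptotics`, from the Petersson fact
`kowalskiMichel2000_petersson` alone (diagonal `≤ ‖P‖²_∞(1 + Δ log q̂)`; off-diagonal
`≪ ‖P‖²_∞ q^{Δ(1+ε) − 3/2} ≤ ‖P‖²_∞` with `ε = (3 − 2Δ)/(4Δ)`).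
[cite: KowalskiMichelVanderKam2000, Lemma 3.2 (12) and (9)]
[cite: KowalskiMichel2000, §2.3 (display after (16))] -/
theorem mollifierNormBound_of_petersson_pb (hP : KowalskiMichel2000.kowalskiMichel2000_peterssonBound)
    (P : ℝ[X]) {Δ : ℝ} (hΔ0 : 0 < Δ) (hΔ : Δ < 3 / 2) :
    ∃ C : ℝ, ∃ q₁ : ℕ, ∀ (q : ℕ) [NeZero q], q.Prime → q₁ ≤ q →
      IwaniecSarnak.harmonicSum q 2 (fun f ↦ ‖mollifierP q P (qhat q ^ Δ) f‖ ^ 2) ≤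
        C * Real.log (qhat q) := by
  -- sup of `|P|` on `[0,1]`
  obtain ⟨B₀, hB₀⟩ := isCompact_Icc.exists_bound_of_continuousOn
    (P.continuous.continuousOn : ContinuousOn (fun t : ℝ ↦ P.eval t) (Set.Icc (0 : ℝ) 1))
  set B : ℝ := max B₀ 0 with hB_def
  have hB0 : 0 ≤ B := le_max_right _ _
  have hB : ∀ t ∈ Set.Icc (0 : ℝ) 1, |P.eval t| ≤ B := fun t ht ↦ by
    have h := hB₀ t ht
    rw [Real.norm_eq_abs] at h
    exact le_trans h (le_max_left _ _)
  -- the Petersson exponent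
  set ε : ℝ := (3 - 2 * Δ) / (4 * Δ) with hε_def
  have hε : 0 < ε := div_pos (by linarith) (by linarith)
  have hΔε : Δ * (1 + ε) ≤ 3 / 2 := by
    rw [hε_def]
    field_simp
    nlinarith
  obtain ⟨C, hC0, hC⟩ := abs_pairSum_sub_delta_le_pb hP hε
  refine ⟨B ^ 2 * (2 + Δ + C), 300, fun q _ hq hq300 ↦ ?_⟩
  have hq1 : 1 ≤ q := le_trans (by norm_num) hq300
  have hq40 : 40 ≤ q := le_trans (by norm_num) hq300
  have hqR1 : (1 : ℝ) ≤ q := by exact_mod_cast hq1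
  have hqhat1 : 1 < qhat q := one_lt_qhat hq40
  have hqhat0 : 0 < qhat q := lt_trans one_pos hqhat1
  set x : ℝ := Real.log (qhat q) with hx_def
  have hx1 : 1 ≤ x := one_le_log_qhat hq300
  set M : ℝ := qhat q ^ Δ with hM_def
  have hM1 : 1 < M := Real.one_lt_rpow hqhat1 hΔ0
  have hM0 : 0 < M := by linarith
  have hlogM : Real.log M = Δ * x := by rw [hM_def, Real.log_rpow hqhat0]
  -- the printed range: `M ≤ q^{Δ/2} < q`, so every mollifier index is prime to `q`
  have hMq : M < (q : ℝ) := by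
    have hq1' : (1 : ℝ) < q := by exact_mod_cast lt_of_lt_of_le (by norm_num) hq300
    calc M ≤ Real.sqrt q ^ Δ := Real.rpow_le_rpow hqhat0.le qhat_le_sqrt hΔ0.le
      _ = (q : ℝ) ^ (1 / 2 * Δ) := by rw [Real.sqrt_eq_rpow, ← Real.rpow_mul (by linarith)]
      _ < (q : ℝ) ^ (1 : ℝ) := Real.rpow_lt_rpow_of_exponent_lt hq1' (by linarith)
      _ = q := Real.rpow_one _
  set I := Icc 1 ⌊M⌋₊ with hI_def
  set xc : ℕ → ℝ := fun m ↦ (ArithmeticFunction.moebius m : ℝ) * ((psi m)⁻¹ *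
    (m : ℝ) ^ (-(1 / 2 : ℝ)) * P.eval (Real.log (M / m) / Real.log M)) with hxc_def
  have hxc : ∀ m ∈ I, |xc m| ≤ B * (m : ℝ) ^ (-(1 / 2 : ℝ)) :=
    fun m hm ↦ abs_mollifierCoeff_le hB hM1 hm
  -- expansion
  rw [harmonicSum_mollifier_norm_sq]
  change ∑ l ∈ I, ∑ m ∈ I, xc l * xc m * pairSum q l m ≤ B ^ 2 * (2 + Δ + C) * x
  -- split off the diagonal
  have hsplit : ∑ l ∈ I, ∑ m ∈ I, xc l * xc m * pairSum q l m =
      ∑ l ∈ I, xc l ^ 2 + ∑ l ∈ I, ∑ m ∈ I, xc l * xc m * (pairSum q l m - if l = m then 1 else 0) := by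
    have hdiag : ∑ l ∈ I, xc l ^ 2 =
        ∑ l ∈ I, ∑ m ∈ I, xc l * xc m * (if l = m then (1 : ℝ) else 0) := by
      refine Finset.sum_congr rfl fun l hl ↦ ?_
      simp only [mul_ite, mul_one, mul_zero, Finset.sum_ite_eq, if_pos hl, sq]
    rw [hdiag, ← Finset.sum_add_distrib]
    refine Finset.sum_congr rfl fun l _ ↦ ?_
    rw [← Finset.sum_add_distrib]
    refine Finset.sum_congr rfl fun m _ ↦ ?_
    ring
  rw [hsplit]
  -- (i) the diagonal: `Σ x_l² ≤ B² Σ_{l ≤ M} 1/l ≤ B² (1 + log M)`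
  have hdiag : ∑ l ∈ I, xc l ^ 2 ≤ B ^ 2 * (1 + Δ * x) := by
    have h1 : ∑ l ∈ I, xc l ^ 2 ≤ ∑ l ∈ I, B ^ 2 * (l : ℝ)⁻¹ := by
      refine Finset.sum_le_sum fun l hl ↦ ?_
      have hl1 : (1 : ℝ) ≤ l := by exact_mod_cast (Finset.mem_Icc.1 hl).1
      have hl0 : (0 : ℝ) < l := by linarith
      have h := hxc l hl
      have hpow2 : ((l : ℝ) ^ (-(1 / 2 : ℝ))) ^ 2 = (l : ℝ)⁻¹ := by
        rw [← Real.rpow_natCast, ← Real.rpow_mul hl0.le]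
        norm_num
        exact Real.rpow_neg_one (l : ℝ)
      calc xc l ^ 2 = |xc l| ^ 2 := (sq_abs _).symm
        _ ≤ (B * (l : ℝ) ^ (-(1 / 2 : ℝ))) ^ 2 := pow_le_pow_left₀ (abs_nonneg _) h 2
        _ = B ^ 2 * (l : ℝ)⁻¹ := by rw [mul_pow, hpow2]
    have h2 : ∑ l ∈ I, B ^ 2 * (l : ℝ)⁻¹ = B ^ 2 * (harmonic ⌊M⌋₊ : ℝ) := by
      rw [← Finset.mul_sum, hI_def]
      simp only [harmonic_eq_sum_Icc, Rat.cast_sum, Rat.cast_inv, Rat.cast_natCast]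
    have h3 : (harmonic ⌊M⌋₊ : ℝ) ≤ 1 + Δ * x := by
      have hfl1 : 1 ≤ ⌊M⌋₊ := Nat.one_le_iff_ne_zero.2 (Nat.floor_pos.2 hM1.le).ne'
      have hfl0 : (0 : ℝ) < (⌊M⌋₊ : ℝ) := by exact_mod_cast hfl1
      calc (harmonic ⌊M⌋₊ : ℝ) ≤ 1 + Real.log (⌊M⌋₊ : ℝ) := harmonic_le_one_add_log _
        _ ≤ 1 + Real.log M := by
            gcongr
            exact Nat.floor_le hM0.le
        _ = 1 + Δ * x := by rw [hlogM]
    calc ∑ l ∈ I, xc l ^ 2 ≤ B ^ 2 * (harmonic ⌊M⌋₊ : ℝ) := by rw [← h2]; exact h1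
      _ ≤ B ^ 2 * (1 + Δ * x) := mul_le_mul_of_nonneg_left h3 (sq_nonneg _)
  -- (ii) the off-diagonal: each term `≤ B² C (M^ε)² q^{-3/2}`, and there are `≤ M²` terms
  have hqpow : 0 < (q : ℝ) ^ (-(3 / 2 : ℝ)) := Real.rpow_pos_of_pos (by linarith) _
  have hterm : ∀ l ∈ I, ∀ m ∈ I,
      |xc l * xc m * (pairSum q l m - if l = m then 1 else 0)| ≤
        B ^ 2 * C * (M ^ ε) ^ 2 * (q : ℝ) ^ (-(3 / 2 : ℝ)) := by
    intro l hl m hm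
    obtain ⟨hl1, hlM⟩ := Finset.mem_Icc.1 hl
    obtain ⟨hm1, hmM⟩ := Finset.mem_Icc.1 hm
    have hl0 : (0 : ℝ) < l := by exact_mod_cast hl1
    have hm0 : (0 : ℝ) < m := by exact_mod_cast hm1
    have hlM' : (l : ℝ) ≤ M := le_trans (by exact_mod_cast hlM) (Nat.floor_le hM0.le)
    have hmM' : (m : ℝ) ≤ M := le_trans (by exact_mod_cast hmM) (Nat.floor_le hM0.le)
    have hmq : m < q := by exact_mod_cast lt_of_le_of_lt hmM' hMq
    have hpair := hC q hq l m hl1 hm1 (KowalskiMichel2000.not_dvd_and_dvd_of_lt hm1 hmq)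
    have hxl := hxc l hl
    have hxm := hxc m hm
    -- `l^{-1/2} m^{-1/2} (lm)^{1/2+ε} = l^ε m^ε ≤ (M^ε)²`
    have hprod : (l : ℝ) ^ (-(1 / 2 : ℝ)) * (m : ℝ) ^ (-(1 / 2 : ℝ)) *
        (((l : ℝ) * m) ^ (1 / 2 + ε)) = (l : ℝ) ^ ε * (m : ℝ) ^ ε := by
      rw [Real.mul_rpow hl0.le hm0.le]
      have el : (l : ℝ) ^ (-(1 / 2 : ℝ)) * (l : ℝ) ^ (1 / 2 + ε) = (l : ℝ) ^ ε := by
        rw [← Real.rpow_add hl0]; norm_num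
      have em : (m : ℝ) ^ (-(1 / 2 : ℝ)) * (m : ℝ) ^ (1 / 2 + ε) = (m : ℝ) ^ ε := by
        rw [← Real.rpow_add hm0]; norm_num
      calc (l : ℝ) ^ (-(1 / 2 : ℝ)) * (m : ℝ) ^ (-(1 / 2 : ℝ)) *
            ((l : ℝ) ^ (1 / 2 + ε) * (m : ℝ) ^ (1 / 2 + ε))
          = ((l : ℝ) ^ (-(1 / 2 : ℝ)) * (l : ℝ) ^ (1 / 2 + ε)) *
              ((m : ℝ) ^ (-(1 / 2 : ℝ)) * (m : ℝ) ^ (1 / 2 + ε)) := by ring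
        _ = (l : ℝ) ^ ε * (m : ℝ) ^ ε := by rw [el, em]
    have hle : (l : ℝ) ^ ε * (m : ℝ) ^ ε ≤ (M ^ ε) ^ 2 := by
      rw [sq]
      exact mul_le_mul (Real.rpow_le_rpow hl0.le hlM' hε.le) (Real.rpow_le_rpow hm0.le hmM' hε.le)
        (Real.rpow_nonneg hm0.le _) (Real.rpow_nonneg hM0.le _)
    rw [abs_mul, abs_mul]
    calc |xc l| * |xc m| * |pairSum q l m - if l = m then 1 else 0|
        ≤ (B * (l : ℝ) ^ (-(1 / 2 : ℝ))) * (B * (m : ℝ) ^ (-(1 / 2 : ℝ))) *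
            (C * (((l : ℝ) * m) ^ (1 / 2 + ε)) * (q : ℝ) ^ (-(3 / 2 : ℝ))) := by
          refine mul_le_mul (mul_le_mul hxl hxm (abs_nonneg _) (by positivity)) hpair
            (abs_nonneg _) (by positivity)
      _ = B ^ 2 * C * ((l : ℝ) ^ (-(1 / 2 : ℝ)) * (m : ℝ) ^ (-(1 / 2 : ℝ)) *
            (((l : ℝ) * m) ^ (1 / 2 + ε))) * (q : ℝ) ^ (-(3 / 2 : ℝ)) := by ring
      _ = B ^ 2 * C * ((l : ℝ) ^ ε * (m : ℝ) ^ ε) * (q : ℝ) ^ (-(3 / 2 : ℝ)) := by rw [hprod]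
      _ ≤ B ^ 2 * C * (M ^ ε) ^ 2 * (q : ℝ) ^ (-(3 / 2 : ℝ)) := by
          refine mul_le_mul_of_nonneg_right (mul_le_mul_of_nonneg_left hle (by positivity))
            hqpow.le
  have hcard : (I.card : ℝ) ≤ M := by
    rw [hI_def, Nat.card_Icc]
    simpa using Nat.floor_le hM0.le
  have hoff : |∑ l ∈ I, ∑ m ∈ I, xc l * xc m * (pairSum q l m - if l = m then 1 else 0)| ≤
      M ^ 2 * (B ^ 2 * C * (M ^ ε) ^ 2 * (q : ℝ) ^ (-(3 / 2 : ℝ))) := by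
    calc |∑ l ∈ I, ∑ m ∈ I, xc l * xc m * (pairSum q l m - if l = m then 1 else 0)|
        ≤ ∑ l ∈ I, |∑ m ∈ I, xc l * xc m * (pairSum q l m - if l = m then 1 else 0)| :=
          Finset.abs_sum_le_sum_abs _ _
      _ ≤ ∑ l ∈ I, ∑ m ∈ I, |xc l * xc m * (pairSum q l m - if l = m then 1 else 0)| :=
          Finset.sum_le_sum fun l _ ↦ Finset.abs_sum_le_sum_abs _ _
      _ ≤ ∑ l ∈ I, ∑ m ∈ I, B ^ 2 * C * (M ^ ε) ^ 2 * (q : ℝ) ^ (-(3 / 2 : ℝ)) :=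
          Finset.sum_le_sum fun l hl ↦ Finset.sum_le_sum fun m hm ↦ hterm l hl m hm
      _ = (I.card : ℝ) ^ 2 * (B ^ 2 * C * (M ^ ε) ^ 2 * (q : ℝ) ^ (-(3 / 2 : ℝ))) := by
          rw [Finset.sum_const, Finset.sum_const, nsmul_eq_mul, nsmul_eq_mul]; ring
      _ ≤ M ^ 2 * (B ^ 2 * C * (M ^ ε) ^ 2 * (q : ℝ) ^ (-(3 / 2 : ℝ))) := by
          refine mul_le_mul_of_nonneg_right (pow_le_pow_left₀ (Nat.cast_nonneg _) hcard 2)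
            (by positivity)
  -- `M² (M^ε)² = (q̂^{Δ(1+ε)})² ≤ q^{Δ(1+ε)} ≤ q^{3/2}`
  have hMpow : M ^ 2 * (M ^ ε) ^ 2 * (q : ℝ) ^ (-(3 / 2 : ℝ)) ≤ 1 := by
    have e1 : M ^ 2 * (M ^ ε) ^ 2 = (qhat q ^ (Δ * (1 + ε))) ^ 2 := by
      rw [← mul_pow, hM_def, ← Real.rpow_mul hqhat0.le, ← Real.rpow_add hqhat0]
      ring_nf
    have e2 : (qhat q ^ (Δ * (1 + ε))) ^ 2 ≤ (q : ℝ) ^ (3 / 2 : ℝ) := by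
      have hΔε0 : 0 ≤ Δ * (1 + ε) := by positivity
      calc (qhat q ^ (Δ * (1 + ε))) ^ 2 ≤ (Real.sqrt q ^ (Δ * (1 + ε))) ^ 2 := by
            refine pow_le_pow_left₀ (Real.rpow_nonneg hqhat0.le _) ?_ 2
            exact Real.rpow_le_rpow hqhat0.le qhat_le_sqrt hΔε0
        _ = (q : ℝ) ^ (Δ * (1 + ε)) := by
            rw [Real.sqrt_eq_rpow, ← Real.rpow_mul (by linarith), ← Real.rpow_natCast,
              ← Real.rpow_mul (by linarith)]
            ring_nf
        _ ≤ (q : ℝ) ^ (3 / 2 : ℝ) := Real.rpow_le_rpow_of_exponent_le hqR1 hΔε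
    have e3 : (q : ℝ) ^ (3 / 2 : ℝ) * (q : ℝ) ^ (-(3 / 2 : ℝ)) = 1 := by
      rw [← Real.rpow_add (by linarith)]; norm_num
    calc M ^ 2 * (M ^ ε) ^ 2 * (q : ℝ) ^ (-(3 / 2 : ℝ))
        ≤ (q : ℝ) ^ (3 / 2 : ℝ) * (q : ℝ) ^ (-(3 / 2 : ℝ)) := by
          rw [e1]; exact mul_le_mul_of_nonneg_right e2 hqpow.le
      _ = 1 := e3
  have hoff' : |∑ l ∈ I, ∑ m ∈ I, xc l * xc m * (pairSum q l m - if l = m then 1 else 0)| ≤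
      B ^ 2 * C := by
    calc |∑ l ∈ I, ∑ m ∈ I, xc l * xc m * (pairSum q l m - if l = m then 1 else 0)|
        ≤ M ^ 2 * (B ^ 2 * C * (M ^ ε) ^ 2 * (q : ℝ) ^ (-(3 / 2 : ℝ))) := hoff
      _ = B ^ 2 * C * (M ^ 2 * (M ^ ε) ^ 2 * (q : ℝ) ^ (-(3 / 2 : ℝ))) := by ring
      _ ≤ B ^ 2 * C * 1 := mul_le_mul_of_nonneg_left hMpow (by positivity)
      _ = B ^ 2 * C := mul_one _
  -- assemble (using `x ≥ 1`)
  have hB2 : 0 ≤ B ^ 2 := sq_nonneg _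
  have hoff'' := (abs_le.1 hoff').2
  have : B ^ 2 * (1 + Δ * x) + B ^ 2 * C ≤ B ^ 2 * (2 + Δ + C) * x := by
    have h1 : B ^ 2 * 1 ≤ B ^ 2 * x := mul_le_mul_of_nonneg_left hx1 hB2
    have h2 : B ^ 2 * C * 1 ≤ B ^ 2 * C * x := mul_le_mul_of_nonneg_left hx1 (by positivity)
    nlinarith
  linarith


end KMV2000

end Literature.NumberTheory.LFunctions

end
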